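import Literature.AlgebraicGeometry.Resolution.TeissierPresentation
import Literature.AlgebraicGeometry.Motives.Varieties
import Mathlib.AlgebraicGeometry.Morphisms.Proper
import Mathlib.AlgebraicGeometry.Pullbacks
import HarnessLib

/-!
# Route `TeissierJung` — definitions posited by the Jung lines of crux `TeissierReduction`
# (stmt-ResolutionOfSingularities-17085)

The crux `TeissierReduction` quantifies the regular base `S` of its predicate `TF` EXISTENTIALLY
(`TF X' = TeissierPresented k X'`, bridge `teissierPresented_iff`), which is what lets a regular
model be its own base (the degenerate witness of `Theorems/TeissierReduction/Negative/ImpliedBySummit`).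
The INTENDED mechanism (Mourtada–Schober, C. R. Math. 363 (2025) p. 4, after Jung; Piltant 2003,
"blow up only the base") fixes a finite projection `π₀ : H → ℙ^d` first and modifies only the
regular base. The two definitions below TYPE that mechanism so that the lines of the crux chain,
the standing disprover and the planners can refer to it by name; they were first written by the
crux-disprover seat (`Cruxes/TeissierReduction/Disproof.lean` §4, refuter-cdisprove-…-17085, gen 1)
and are moved here UNCHANGED so that `Theorems/` files may import them (a `Cruxes/` work file is not
importable from `Theorems/`).

* `TeissierPresentedOver k π g` — the body of `TeissierPresented k X'` with its leading `∃ S g π`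
  removed: `X'` is integral and finite over the regular integral separated finite-type `k`-scheme
  `S` VIA `π`, and every analytic branch at every closed point carries a Teissier presentation over
  `𝒪̂_{S,π x} ≅ k⟦x₁..x_d⟧` compatible with `π`.
* `teissierPresented_iff_exists_over` — `TeissierPresented k X' ↔ ∃ S g π, TeissierPresentedOver k π g`
  (definitional).
* `TeissierReductionJung` — Jung's reduction to the Teissier class with only the base modified: for
  every integral hypersurface `H ⊆ ℙᵐ_k` (`k` algebraically closed of characteristic `p`) there are
  a finite surjective `π₀ : H → ℙ^d`, a proper birational `σ : S → ℙ^d`, and the fibre product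
  `H ×_{ℙ^d} S → S` is Teissier-presented OVER `S`. (Mourtada–Schober's printed open question; no
  theorem about it is claimed here. Its transfer to the crux, `TeissierReductionJung → TeissierReduction`,
  is a separate `Theorems/` file of the crux chain.)

No new mathematics: two `def`s and one `Iff.rfl`.
-/

-- single-problem summit: the doubled namespace component `ResolutionOfSingularities` is forced
set_option linter.dupNamespace false

noncomputable section

open CategoryTheory CategoryTheory.Limits AlgebraicGeometry TopologicalSpace
open Literature.AlgebraicGeometry.Resolution

namespace Summit.ResolutionOfSingularities.ResolutionOfSingularities.Theorems.TeissierReduction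

universe u

/-- **Teissier-presented OVER a given base.** `TF` with the base GIVEN: `X'` is integral and finite
over the regular integral separated finite-type `k`-scheme `S` VIA `π` (`g : S → Spec k` the
structure map), and every analytic branch `𝒪̂_{X',x} ⧸ P` at every closed point `x` carries a
Teissier presentation over some `φ : 𝒪̂_{S,π x} ≅ k⟦x₁..x_d⟧`, compatibly with the stalk map of
`π` — the body of `TeissierPresented k X'` with its leading `∃ S g π` removed.
[cite: MourtadaSchober2025, Def. 2.3 and §3 (display preceding Prop. 3.1)] -/
def TeissierPresentedOver (k : Type u) [Field k] {X' S : Scheme.{u}} (π : X' ⟶ S)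
    (g : S ⟶ Spec (.of k)) : Prop :=
  IsSeparated g ∧ LocallyOfFiniteType g ∧ QuasiCompact g ∧ IsIntegral S ∧ Scheme.IsRegular S ∧
    IsIntegral X' ∧ IsFinite π ∧
    ∀ x : X', IsClosed ({x} : Set X') →
      ∀ P ∈ minimalPrimes
          (AdicCompletion (IsLocalRing.maximalIdeal (X'.presheaf.stalk x)) (X'.presheaf.stalk x)),
        ∃ (d : ℕ)
          (φ : AdicCompletion (IsLocalRing.maximalIdeal (S.presheaf.stalk (π.base x)))
              (S.presheaf.stalk (π.base x)) ≃+* MvPowerSeries (Fin d) k)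
          (ι : MvPowerSeries (Fin d) k →+*
            AdicCompletion (IsLocalRing.maximalIdeal (X'.presheaf.stalk x)) (X'.presheaf.stalk x) ⧸ P),
          TeissierPresentation k d _ ι ∧
            ∀ a : S.presheaf.stalk (π.base x),
              ι (φ (algebraMap _ _ a)) = Ideal.Quotient.mk P (algebraMap _ _ ((π.stalkMap x).hom a))

/-- `TeissierPresented k X' ↔ ∃ S g π, TeissierPresentedOver k π g` (definitional). [folklore] -/
theorem teissierPresented_iff_exists_over (k : Type u) [Field k] (X' : Scheme.{u}) :
    TeissierPresented k X' ↔
      ∃ (S : Scheme.{u}) (g : S ⟶ Spec (.of k)) (π : X' ⟶ S), TeissierPresentedOver k π g :=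
  Iff.rfl

/-- `TeissierPresentedOver` forgets to `TeissierPresented`. [folklore] -/
theorem TeissierPresentedOver.teissierPresented {k : Type u} [Field k] {X' S : Scheme.{u}}
    {π : X' ⟶ S} {g : S ⟶ Spec (.of k)} (h : TeissierPresentedOver k π g) :
    TeissierPresented k X' :=
  ⟨S, g, π, h⟩

/-- `TeissierPresentedOver` records that `X'` is integral. [folklore] -/
theorem TeissierPresentedOver.isIntegral {k : Type u} [Field k] {X' S : Scheme.{u}}
    {π : X' ⟶ S} {g : S ⟶ Spec (.of k)} (h : TeissierPresentedOver k π g) : IsIntegral X' :=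
  h.2.2.2.2.2.1

/-- `TeissierPresentedOver` records that `π` is finite. [folklore] -/
theorem TeissierPresentedOver.isFinite {k : Type u} [Field k] {X' S : Scheme.{u}}
    {π : X' ⟶ S} {g : S ⟶ Spec (.of k)} (h : TeissierPresentedOver k π g) : IsFinite π :=
  h.2.2.2.2.2.2.1

/-- **`TeissierReductionJung`** — the INTENDED form of crux `TeissierReduction` (Jung's reduction
to the Teissier class, Mourtada–Schober 2025 p. 4; Piltant 2003 "blow up only the base"): for every
prime `p`, every algebraically closed `k` of characteristic `p` and every integral closed
`H ⊆ ℙᵐ_k` with locally principal ideal, there are a finite surjective projection `π₀ : H → ℙ^d`,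
a scheme `S` with a proper birational `σ : S → ℙ^d`, such that the fibre product `H ×_{ℙ^d} S`,
with its projection `pullback.snd π₀ σ` to `S`, is Teissier-presented OVER `S` (in particular `S`
is regular, integral, separated of finite type, and the fibre product is integral and finite over
`S`). A route-posited OPEN statement (the object the Jung lines of the crux chain aim at; not a
published result — it is Mourtada–Schober's printed open question, C. R. Math. 363 (2025) p. 4, typed);
nothing about it is asserted here. Informal sources of the programme: MourtadaSchober2025 p. 4,
Piltant2003 (surfaces: "blow up only the base"). -/
def TeissierReductionJung : Prop :=
  ∀ p : ℕ, p.Prime → ∀ (k : Type) [Field k] [CharP k p] [IsAlgClosed k] (m : ℕ) (H : Scheme.{0})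
    (ι' : H ⟶ (Literature.AlgebraicGeometry.Motives.projectiveSpace m k).left),
    IsClosedImmersion ι' → IsIntegral H →
    (∀ y : (Literature.AlgebraicGeometry.Motives.projectiveSpace m k).left,
      ∃ U : (Literature.AlgebraicGeometry.Motives.projectiveSpace m k).left.affineOpens,
        y ∈ (U : (Literature.AlgebraicGeometry.Motives.projectiveSpace m k).left.Opens) ∧
        (ι'.ker.ideal U).IsPrincipal) →
    ∃ (d : ℕ) (π₀ : H ⟶ (Literature.AlgebraicGeometry.Motives.projectiveSpace d k).left)
      (S : Scheme.{0}) (σ : S ⟶ (Literature.AlgebraicGeometry.Motives.projectiveSpace d k).left),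
      IsFinite π₀ ∧ Function.Surjective π₀.base ∧ IsProper σ ∧ IsBirational σ ∧
      TeissierPresentedOver k (pullback.snd π₀ σ)
        (σ ≫ (Literature.AlgebraicGeometry.Motives.projectiveSpace d k).hom)

end Summit.ResolutionOfSingularities.ResolutionOfSingularities.Theorems.TeissierReduction

end
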